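import Literature.AlgebraicGeometry.Motives.ZariskiChowCover
import Literature.AlgebraicGeometry.Motives.GoodReductionCechProofs
import Literature.AlgebraicGeometry.Morphisms.CechH1ProjectiveFinite
import Literature.AlgebraicGeometry.Resolution.ChowLemmaRing
import Literature.AlgebraicGeometry.Resolution.ReducedOfSmoothOverReduced
import HarnessLib

/-!
# Zariski's connectedness theorem for smooth proper models — discharge of `geometricallyIrreducible_reductionAt`

`Literature.AlgebraicGeometry.Motives.IntegralModel.geometricallyIrreducible_reductionAt_holds` proves the
named fact `IntegralModel.geometricallyIrreducible_reductionAt` of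
`Literature/AlgebraicGeometry/Motives/GoodReduction.lean`: for a smooth projective geometrically
irreducible `X` over a number field `K` and a smooth proper model `𝒳 → Spec 𝓞_{K,v}`, the reduction
`𝒳 ×_{𝓞_{K,v}} κ(v)` is geometrically irreducible (Stacks Project, Tag 0E0N/03H0 with 056T; SGA 1 X 1.2).

The earlier files reduced this to the surjectivity half of the theorem on formal functions for `H⁰`
of the MODEL (`geometricallyIrreducible_reductionAt_of_hasSurjectiveFormalFunctions`,
`Literature/AlgebraicGeometry/Motives/GoodReductionFormalFunctionsProofs`), available from the finiteness
of `Ȟ¹(𝒳, 𝒪)` (`Literature/AlgebraicGeometry/Morphisms/FormalFunctionsCechProofs`), i.e. from the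
coherence theorem for proper morphisms. This file avoids coherence for proper morphisms by running
Zariski's argument on a PROJECTIVE cover, where Serre's explicit computation is available:

1. `isIntegral_total` — `𝒳` is integral (reduced: smooth over the reduced `Spec 𝓞_{K,v}`,
   `Resolution.isReduced_of_smooth_of_isReduced_base`, Stacks 034E; irreducible: the generic fibre
   `𝒳_K ≅ X` is irreducible and dense, `ZariskiChow.irreducibleSpace_of_genericFibre`).
2. Chow's lemma over `𝓞_{K,v}` (`Resolution.ChowLemmaRing.chow_proper`, Görtz–Wedhorn Thm. 13.100 /
   Stacks 02O2): `π : Z → 𝒳` proper surjective, `Z` integral with a closed immersion `Z ↪ ℙᴺ_{𝓞_{K,v}}`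
   over `𝓞_{K,v}`, `π` an isomorphism over a dense open `U`.
3. `Z → Spec 𝓞_{K,v}` is flat (`ZariskiChow.flat_of_isIntegral_of_surjective`, Hartshorne III 9.7),
   `Γ(Z, 𝒪_Z) = 𝓞_{K,v}` (`bijective_appTop_of_genericFibre`, Stacks 0AY8, with
   `ZariskiChow.mem_range_of_isIntegralElem_chowCover`), and `Ȟ¹(Z, 𝒪_Z)` on the cover `Z ∩ D₊(x_i)` is a
   finitely generated `𝓞_{K,v}`-module — Serre's finiteness theorem, Hartshorne III Thm. 5.2 (a),
   proved algebraically in `Literature/Algebra/Homology/LaurentCech*`, `SerreFiniteness` and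
   `Literature/AlgebraicGeometry/Morphisms/CechH1Projective*` (`ProjCech.moduleFinite_cechH1`); hence
   the theorem on formal functions for `H⁰` holds for `Z` (`hasSurjectiveFormalFunctions_of_finite_cechH1`,
   Stacks 02OC).
4. `isIso_appTop_reductionAt_zariski` — **`H⁰(𝒳_v, 𝒪) = κ(v)`**: a function `b` on the reduced fibre
   `𝒳_v` is integral over the perfect field `κ(v)` and a simple root of its minimal polynomial
   (`isUnit_aeval_derivative_minpoly`); its pull-back to `Z_v` is constant by Hensel lifting along the
   infinitesimal neighbourhoods of `Z_v` and the theorem on formal functions for `Z`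
   (`mem_range_algebraMapΓ_of_isRoot`, the proof of Stacks 03H0), and `Z_v → 𝒳_v` is surjective, so `b` is
   constant (`isNilpotent_of_app_eq_zero`).
5. `geometricallyConnected_reductionAt_zariski` — flat base change of `H⁰`
   (`geometricallyConnected_of_isIso_appTop`, Stacks 02KH) gives geometric connectedness, and smoothness
   gives geometric irreducibility (`geometricallyIrreducible_of_geometricallyConnected_of_smoothOfRelativeDimension`,
   Stacks 056T): `geometricallyIrreducible_reductionAt_holds`.

Everything is proved; the trust base is Mathlib (`#print axioms`: `propext`, `Classical.choice`,
`Quot.sound`). No named facts are introduced; the named facts `Morphisms.cechH1_finite`,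
`Morphisms.formalFunctions_H0`, `steinFactorization_geometricallyConnected` of the earlier conditional
routes are not used.

## References

* The Stacks Project, Tags 03H0 (More on Morphisms, Theorem 37.53.4, Zariski's connectedness theorem,
  proof), 0AY8, 02OC (Cohomology of Schemes, Theorem 30.20.5), 02O2 (Chow's lemma), 056T, 0E0N.
  [StacksProject]
* R. Hartshorne, *Algebraic Geometry*, GTM 52 (1977): III Thm. 5.2 (a), III Cor. 11.3, III Prop. 9.7,
  II Ex. 4.10. [Hartshorne1977]
* U. Görtz, T. Wedhorn, *Algebraic Geometry I*, 2nd ed. (2020), Theorem 13.100. [GortzWedhorn2020]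
* A. Grothendieck, EGA III₁ (Publ. Math. IHÉS 11, 1961), Théorème 4.3.1; SGA 1, Exposé X, 1.2.
-/

noncomputable section

universe u

open CategoryTheory CategoryTheory.Limits AlgebraicGeometry TopologicalSpace Opposite Polynomial

namespace Literature.AlgebraicGeometry.Resolution.ChowLemmaRing

/-- Bridge to the field-only spelling of `Literature/AlgebraicGeometry/Motives/Varieties.lean`: over a
field `k`, `projOver k n` is `Motives.projectiveSpace n k` (by `rfl`). [folklore] -/
theorem projOver_eq_projectiveSpace (k : Type u) [Field k] (n : ℕ) :
    projOver k n = Motives.projectiveSpace n k := rfl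

/-- Over a field, `IsProjOver` is `Motives.IsProjectiveOver` (by `Iff.rfl`). [folklore] -/
theorem isProjOver_iff_isProjectiveOver {k : Type u} [Field k] (X : Motives.SchemeOver k) :
    IsProjOver X ↔ Motives.IsProjectiveOver X := Iff.rfl

end Literature.AlgebraicGeometry.Resolution.ChowLemmaRing

namespace Literature.AlgebraicGeometry.Motives.IntegralModel

open scoped NumberField

open IsDedekindDomain IsDedekindDomain.HeightOneSpectrum Morphisms

variable {K : Type} [Field K] [NumberField K] {v : HeightOneSpectrum (𝓞 K)} {X : SchemeOver K}
  (𝒳 : IntegralModel (valuationSubringAtPrime K v) K X)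

/-- **The generic fibre `𝒳_K ≅ X` of a smooth proper model of a smooth projective geometrically
irreducible `X/K` is integral and geometrically irreducible over `K`** (as in
`bijective_algebraMapΓ`). [folklore] -/
theorem isIntegral_genericFibre {n : ℕ} (hX : IsSmoothProjective n X) (h : 𝒳.IsSmoothProper n) :
    IsIntegral (pullback 𝒳.total.hom (Spec.map (CommRingCat.ofHom (algebraMap (valuationSubringAtPrime K v) K)))) ∧
      GeometricallyIrreducible
        (pullback.snd 𝒳.total.hom (Spec.map (CommRingCat.ofHom (algebraMap (valuationSubringAtPrime K v) K)))) := by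
  haveI := h.1
  haveI := smoothOfRelativeDimension_isStableUnderBaseChange (n := n)
  set i : Spec (.of K) ⟶ Spec (.of (valuationSubringAtPrime K v)) :=
    Spec.map (CommRingCat.ofHom (algebraMap (valuationSubringAtPrime K v) K)) with hi
  have hgK : pullback.snd 𝒳.total.hom i = 𝒳.genericIso.hom.left ≫ X.hom := (Over.w 𝒳.genericIso.hom).symm
  haveI : @IsIso _ _ (pullback 𝒳.total.hom i) X.left 𝒳.genericIso.hom.left :=
    inferInstanceAs (IsIso ((Over.forget _).mapIso 𝒳.genericIso).hom)
  haveI hgi : GeometricallyIrreducible (pullback.snd 𝒳.total.hom i) := by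
    rw [hgK]
    exact MorphismProperty.RespectsIso.precomp (P := @GeometricallyIrreducible) _ _ hX.geometricallyIrreducible
  haveI : IrreducibleSpace ↥(pullback 𝒳.total.hom i) :=
    GeometricallyIrreducible.irreducibleSpace_of_subsingleton (f := pullback.snd 𝒳.total.hom i)
  haveI : SmoothOfRelativeDimension n (pullback.snd 𝒳.total.hom i) := MorphismProperty.pullback_snd _ _ ‹_›
  haveI : IsReduced (pullback 𝒳.total.hom i) := isReduced_of_smoothOfRelativeDimension (pullback.snd 𝒳.total.hom i) n
  exact ⟨isIntegral_of_irreducibleSpace_of_isReduced _, hgi⟩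

/-- **The total space of a smooth proper model of a smooth projective geometrically irreducible
`X/K` is an integral scheme**: it is reduced (smooth over the reduced Noetherian `Spec 𝓞_{K,v}`,
`Resolution.isReduced_of_smooth_of_isReduced_base`, Stacks 034E) and irreducible, its generic fibre
`𝒳_K ≅ X` being irreducible and dense (`ZariskiChow.irreducibleSpace_of_genericFibre`: `𝒳 → Spec 𝓞_{K,v}`
is universally open). [folklore] -/
theorem isIntegral_total {n : ℕ} (hX : IsSmoothProjective n X) (h : 𝒳.IsSmoothProper n) :
    IsIntegral 𝒳.total.left := by
  haveI := h.1
  haveI := h.2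
  haveI : Smooth 𝒳.total.hom := SmoothOfRelativeDimension.smooth n _
  haveI := (𝒳.isIntegral_genericFibre hX h).1
  haveI : IrreducibleSpace ↥𝒳.total.left := ZariskiChow.irreducibleSpace_of_genericFibre (K := K) 𝒳.total.hom
  haveI : IsReduced 𝒳.total.left := Resolution.isReduced_of_smooth_of_isReduced_base 𝒳.total.hom
  exact isIntegral_of_irreducibleSpace_of_isReduced _

/-- **`H⁰(𝒳_v, 𝒪) = κ(v)` for the special fibre of a smooth proper model**, unconditionally. Let
`X/K` be smooth projective geometrically irreducible and `𝒳 → Spec 𝓞_{K,v}` a smooth proper model.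
Then `κ(v) → Γ(𝒳_v, 𝒪)` is an isomorphism. Proof (Zariski's connectedness theorem via a projective
cover): by Chow's lemma over `𝓞_{K,v}` (`Resolution.ChowLemmaRing.chow_proper`) there is an integral
`Z`, projective over `𝓞_{K,v}` (`ι : Z ↪ ℙᴺ`), with `π : Z → 𝒳` proper surjective and an isomorphism
over a dense open `U`; `Z` is flat over the discrete valuation ring `𝓞_{K,v}`
(`ZariskiChow.flat_of_isIntegral_of_surjective`), `Γ(Z, 𝒪_Z) = 𝓞_{K,v}`
(`bijective_appTop_of_genericFibre` with `ZariskiChow.mem_range_of_isIntegralElem_chowCover`), and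
`Ȟ¹(Z, 𝒪_Z)` is finitely generated (Serre, `ProjCech.moduleFinite_cechH1`), so the theorem on formal
functions holds for `Z` (`hasSurjectiveFormalFunctions_of_finite_cechH1`). A function `b` on the
reduced fibre `𝒳_v` is integral over `κ(v)` and a simple root of its minimal polynomial; its pull-back
to `Z_v` is then constant (`mem_range_algebraMapΓ_of_isRoot`), and `Z_v → 𝒳_v` is surjective, so `b`
is constant (`isNilpotent_of_app_eq_zero`). [cite: StacksProject, Tags 02O2, 02OC and 03H0 (Chow's lemma; theorem on formal functions; Zariski's connectedness theorem, proof)] -/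
theorem isIso_appTop_reductionAt_zariski {n : ℕ} (hX : IsSmoothProjective n X) (h : 𝒳.IsSmoothProper n) :
    IsIso (pullback.snd 𝒳.total.hom (Spec.map (CommRingCat.ofHom (residueAt v)))).appTop := by
  classical
  haveI := h.1
  haveI := h.2
  haveI : Smooth 𝒳.total.hom := SmoothOfRelativeDimension.smooth n _
  haveI := smoothOfRelativeDimension_isStableUnderBaseChange (n := n)
  haveI hDVR := isDiscreteValuationRing_valuationSubringAtPrime v
  haveI : IsOpenImmersion (Spec.map (CommRingCat.ofHom (algebraMap (valuationSubringAtPrime K v) K))) :=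
    ZariskiChow.isOpenImmersion_specMap_algebraMap (valuationSubringAtPrime K v) K
  haveI := (𝒳.isIntegral_genericFibre hX h).1
  haveI := (𝒳.isIntegral_genericFibre hX h).2
  haveI : IsIntegral 𝒳.total.left := 𝒳.isIntegral_total hX h
  haveI : Surjective 𝒳.total.hom := 𝒳.surjective_total_hom hX h
  set f := 𝒳.total.hom with hf
  set q := residueAt v with hq
  have hqs : Function.Surjective q := residueAt_surjective v
  /- Chow's lemma over `𝓞_{K,v}` -/
  obtain ⟨N, Z, π, ι, hZint, hιci, hπproper, hπsurj, hιf, U, hUdense, -, hUiso⟩ :=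
    Resolution.ChowLemmaRing.chow_proper 𝒳.total.left f
  haveI := hZint; haveI := hπproper; haveI := hπsurj; haveI := hUiso
  -- the closed immersion `ι : Z ↪ ℙᴺ`, at the type used by `ProjCech`
  haveI hιci' : IsClosedImmersion (Y := Morphisms.ProjCech.PP (valuationSubringAtPrime K v) N) ι := hιci
  have hUne : (U : Set 𝒳.total.left).Nonempty := hUdense.nonempty
  set g : Z ⟶ Spec (.of (valuationSubringAtPrime K v)) := π ≫ f with hg
  haveI : Surjective g := inferInstance
  haveI : IsProper g := inferInstance
  haveI : Flat g := ZariskiChow.flat_of_isIntegral_of_surjective g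
  /- `Γ(Z, 𝒪_Z) = 𝓞_{K,v}` -/
  haveI : Nonempty ↥(pullback g (Spec.map (CommRingCat.ofHom (algebraMap (valuationSubringAtPrime K v) K)))) := by
    obtain ⟨w⟩ := ZariskiChow.nonempty_preimage_preimage (K := K) f π U hUne
    exact ⟨w.1⟩
  have hΓ : Function.Bijective g.appTop :=
    bijective_appTop_of_genericFibre (K := K) g fun b hb =>
      ZariskiChow.mem_range_of_isIntegralElem_chowCover (K := K) f π U hUne b hb
  have hΓ' : Function.Bijective (algebraMapΓ g) :=
    hΓ.comp (Scheme.ΓSpecIso (.of (valuationSubringAtPrime K v))).symm.commRingCatIsoToRingEquiv.bijective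
  /- the theorem on formal functions for `Z` (Serre finiteness for the projective `Z`) -/
  have hstr : Morphisms.ProjCech.strZ ι = g := hιf
  haveI : Flat (Morphisms.ProjCech.strZ ι) := by rw [hstr]; infer_instance
  have hfin := Morphisms.ProjCech.moduleFinite_cechH1 ι
  obtain ⟨ϖ, hϖ, hker⟩ := exists_ker_residueAt_eq_span (K := K) (v := v)
  have hFF0 := Morphisms.hasSurjectiveFormalFunctions_of_finite_cechH1 (f := Morphisms.ProjCech.strZ ι) hϖ
    (Morphisms.ProjCech.cover ι) (Morphisms.ProjCech.isAffineOpen_cover ι) (Morphisms.ProjCech.iSup_cover_eq_top ι) hfin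
  have hFF : HasSurjectiveFormalFunctions (RingHom.ker q) g := by
    rw [hq, hker, ← hstr]; exact hFF0
  /- the fibres over `v` -/
  set j := Spec.map (CommRingCat.ofHom q) with hj
  set gk := pullback.snd f j with hgk
  set Λ := Γ(pullback f j, ⊤) with hΛ
  haveI : SmoothOfRelativeDimension n gk := MorphismProperty.pullback_snd _ _ ‹_›
  haveI : IsReduced (pullback f j) := isReduced_of_smoothOfRelativeDimension gk n
  haveI : Nonempty ↥(pullback f j) := by
    obtain ⟨y, -⟩ := gk.surjective (Classical.arbitrary _)
    exact ⟨y⟩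
  -- the comparison `Z_v → 𝒳_v`, a base change of `π`, hence surjective
  have e₂ : j = 𝟙 _ ≫ j := (Category.id_comp _).symm
  set mk := pullback.map g j f j π (𝟙 _) (𝟙 _) ((Category.comp_id _).trans hg) ((Category.comp_id _).trans e₂)
    with hmk
  haveI : Surjective mk := MorphismProperty.pullbackMap (P := @Surjective) inferInstance inferInstance hg e₂
  have hmk₂ : mk ≫ gk = pullback.snd g j := by
    rw [hmk, hgk, pullback.lift_snd, Category.comp_id]
  have hcomp : algebraMapΓ (pullback.snd g j) = mk.appTop.hom.comp (algebraMapΓ gk) := by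
    rw [algebraMapΓ, algebraMapΓ, ← hmk₂, Scheme.Hom.comp_appTop]
    rfl
  /- every function on `𝒳_v` is constant -/
  letI : Algebra v.asIdeal.ResidueField Λ := (algebraMapΓ gk).toAlgebra
  set ek := Scheme.ΓSpecIso (.of v.asIdeal.ResidueField) with hek
  have hint : ∀ x : Λ, IsIntegral v.asIdeal.ResidueField x := by
    intro x
    obtain ⟨p, hp, hpx⟩ := isIntegral_appTop_of_universallyClosed gk x
    refine ⟨p.map ek.hom.hom, hp.map _, ?_⟩
    rw [Polynomial.eval₂_map]
    convert hpx using 2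
    ext a
    change gk.appTop.hom (ek.inv (ek.hom a)) = gk.appTop.hom a
    rw [Iso.hom_inv_id_apply]
  have hsurj : Function.Surjective (algebraMapΓ gk) := by
    intro b
    have hu := isUnit_aeval_derivative_minpoly (hint b)
    set μ := minpoly v.asIdeal.ResidueField b with hμ
    have hroot : (μ.map (algebraMapΓ gk)).IsRoot b := by
      rw [IsRoot.def, eval_map]; exact minpoly.aeval _ b
    have hroot' : (μ.map (algebraMapΓ (pullback.snd g j))).IsRoot (mk.appTop b) := by
      rw [hcomp, ← Polynomial.map_map]
      exact IsRoot.map hroot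
    have hunit' : IsUnit ((μ.map (algebraMapΓ (pullback.snd g j))).derivative.eval (mk.appTop b)) := by
      rw [hcomp, ← Polynomial.map_map, Polynomial.derivative_map, eval_map, eval₂_hom]
      refine (IsUnit.map _ ?_)
      rw [Polynomial.derivative_map, eval_map]
      exact hu
    obtain ⟨c, hc⟩ := mem_range_algebraMapΓ_of_isRoot g q hFF hqs hΓ' μ (minpoly.monic (hint b))
      (mk.appTop b) hroot' hunit'
    -- `b - c` pulls back to `0` on `Z_v`, hence is nilpotent, hence zero
    have h0 : mk.app ⊤ (b - algebraMapΓ gk c) = 0 := by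
      change mk.appTop (b - algebraMapΓ gk c) = 0
      rw [map_sub, sub_eq_zero, ← hc, hcomp]
      rfl
    haveI : CompactSpace ↥(pullback f j) := QuasiCompact.compactSpace_of_compactSpace gk
    have hnil := isNilpotent_of_app_eq_zero mk (U := ⊤) isCompact_univ _ h0
    exact ⟨c, (sub_eq_zero.mp hnil.eq_zero).symm⟩
  haveI : Nonempty ↥(⊤ : (pullback f j).Opens) := ⟨⟨Classical.arbitrary _, trivial⟩⟩
  have hinj : Function.Injective (algebraMapΓ gk) := (algebraMapΓ gk).injective
  have hbij : Function.Bijective gk.appTop := by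
    have : gk.appTop.hom = (algebraMapΓ gk).comp ek.hom.hom := by
      ext a
      change gk.appTop.hom a = gk.appTop.hom (ek.inv (ek.hom a))
      rw [Iso.hom_inv_id_apply]
    change Function.Bijective gk.appTop.hom
    rw [this]
    exact (Function.Bijective.of_comp_iff' ⟨hinj, hsurj⟩ _).mpr ek.commRingCatIsoToRingEquiv.bijective
  exact (ConcreteCategory.isIso_iff_bijective _).mpr hbij

/-- **Zariski's connectedness theorem for the special fibre of a smooth proper model** (unconditional
form of `geometricallyConnected_reductionAt`): the reduction `𝒳 ×_{𝓞_{K,v}} κ(v)` of a smooth proper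
model of a smooth projective geometrically irreducible `X/K` is geometrically connected
(`H⁰(𝒳_v, 𝒪) = κ(v)` by `isIso_appTop_reductionAt_zariski`, then flat base change,
`geometricallyConnected_of_isIso_appTop`). [cite: StacksProject, Tag 03H0 (More on Morphisms, Theorem 37.53.4) with Tags 02O2, 02OC] -/
theorem geometricallyConnected_reductionAt_zariski {n : ℕ} (hX : IsSmoothProjective n X)
    (h : 𝒳.IsSmoothProper n) :
    GeometricallyConnected (pullback.snd 𝒳.total.hom (Spec.map (CommRingCat.ofHom (residueAt v)))) := by
  haveI := 𝒳.isIso_appTop_reductionAt_zariski hX h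
  haveI := h.1
  haveI := h.2
  haveI := smoothOfRelativeDimension_isStableUnderBaseChange (n := n)
  haveI := 𝒳.surjective_total_hom hX h
  set gk := pullback.snd 𝒳.total.hom (Spec.map (CommRingCat.ofHom (residueAt v))) with hgk
  haveI : Nonempty ↥(pullback 𝒳.total.hom (Spec.map (CommRingCat.ofHom (residueAt v)))) := by
    obtain ⟨y, -⟩ := gk.surjective (Classical.arbitrary _)
    exact ⟨y⟩
  haveI : CompactSpace ↥(pullback 𝒳.total.hom (Spec.map (CommRingCat.ofHom (residueAt v)))) :=
    QuasiCompact.compactSpace_of_compactSpace gk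
  haveI : QuasiSeparatedSpace ↥(pullback 𝒳.total.hom (Spec.map (CommRingCat.ofHom (residueAt v)))) :=
    quasiSeparatedSpace_of_quasiSeparated gk
  exact geometricallyConnected_of_isIso_appTop gk

/-- **Discharge of the named fact `geometricallyIrreducible_reductionAt`** (`Literature/AlgebraicGeometry/
Motives/GoodReduction.lean`): if `X/K` is smooth projective and geometrically irreducible and `𝒳` is a
smooth proper model of `X` over `𝓞_{K,v}`, then the reduction `𝒳 ×_{𝓞_{K,v}} κ(v)` is geometrically
irreducible. It is geometrically connected by Zariski's connectedness theorem
(`geometricallyConnected_reductionAt_zariski`: Chow's lemma over `𝓞_{K,v}`, Serre's finiteness of `H¹`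
of the projective cover, the theorem on formal functions for `H⁰`, Hensel lifting of simple roots — the
printed proof of Stacks Project, Tag 03H0 with Tag 02OC, run on a projective cover) and smooth over
`κ(v)`, hence geometrically irreducible (Stacks Project, Tag 056T,
`geometricallyIrreducible_of_geometricallyConnected_of_smoothOfRelativeDimension`).
[cite: StacksProject, Tags 03H0, 02OC, 02O2 and 056T (More on Morphisms, Theorem 37.53.4; Cohomology of Schemes, Theorem 30.20.5 and Lemma 30.18.1; Varieties, Lemma 33.25.4)] -/
theorem geometricallyIrreducible_reductionAt_holds : 𝒳.geometricallyIrreducible_reductionAt := by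
  intro n hX h
  haveI := 𝒳.geometricallyConnected_reductionAt_zariski hX h
  haveI := h.1
  haveI := smoothOfRelativeDimension_isStableUnderBaseChange (n := n)
  haveI : SmoothOfRelativeDimension n
      (pullback.snd 𝒳.total.hom (Spec.map (CommRingCat.ofHom (residueAt v)))) :=
    MorphismProperty.pullback_snd _ _ ‹_›
  exact geometricallyIrreducible_of_geometricallyConnected_of_smoothOfRelativeDimension
    (pullback.snd 𝒳.total.hom (Spec.map (CommRingCat.ofHom (residueAt v)))) n

end Literature.AlgebraicGeometry.Motives.IntegralModel
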